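import Literature.AnabelianGeometry.SemiGraphs.CuspOmissionSubgraph
import Literature.AnabelianGeometry.SemiGraphs.SurfaceTypeTotallyElevated

/-!
# [SemiAnbd] Cor. 2.7 (i) for semi-graphs of anabelioids of surface type WITH cusps ([SemiAnbd] Ex. 2.10; [IUTchI] §2 p. 44) — PROOFS

Mochizuki, *Inter-universal Teichmüller theory I*, §2 p. 44 l. 24–30: for `𝔾` a semi-graph of
anabelioids of pro-`Σ` PSC-type and a connected sub-semi-graph `ℍ ⊆ 𝔾`, "the restriction of `ℋ`
to the maximal subgraph of `ℍ` coincides with the restriction to the maximal subgraph of the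
underlying semi-graph of some semi-graph of anabelioids of pro-`Σ` PSC-type … up to the possible
omission of some of the cuspidal edges, `ℋ` “is” a semi-graph of anabelioids of pro-`Σ` PSC-type",
whence (Prop. 2.2, p. 46) `C_{Π̂_𝔾}(Π̂_ℍ) = Π̂_ℍ` "by the evident pro-`Σ̂` analogue of [SemiAnbd],
Corollary 2.7, (i)" [cite: Mochizuki2012, §2 p.44]; Mochizuki, *Semi-graphs of anabelioids*,
Publ. RIMS **42** (2006), Example 2.10 p. 31 (semi-graphs of anabelioids arising from pointed
stable curves are coherent, totally elevated, …) and Cor. 2.7 (i) p. 30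
[cite: MochizukiSemiAnbd2006, Ex. 2.10 p.31].

Proof-only companion of `CuspOmissionSubgraph.lean` (abc-iut-L3-t1 g3) closing the remaining
hypotheses of its consumer theorems for semi-graphs of anabelioids OF SURFACE TYPE
(`IsOfSurfaceType`, the tree's interface for Example 2.10 — the [SemiAnbd] face of "pro-`Σ`
PSC-type"):

* `IsOfSurfaceType.restrict` — surface type passes to the restriction `𝒢_ℍ` to ANY sub-semi-graph
  (same vertex groups, a sub-family of the branches, the cusp assignment restricted stays injective);
* `everyEdgeAbuts_restrict_maximalSubgraph` — after omitting the open edges every edge abuts to a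
  vertex;
* `isQuasiCoherent_restrict_maximalSubgraph_of_isOfSurfaceType`,
  `isTotallyElevated_restrict_maximalSubgraph_of_isOfSurfaceType` — by abc-iut-L3-t11's
  `isQuasiCoherent_of_isOfSurfaceType` / `isTotallyElevated_of_isOfSurfaceType` ([SemiAnbd]
  Ex. 2.10 (1)(2), PROVED in the tree) applied to `𝒢_{𝔾_max}`;
* `isCommensurablyTerminal_range_piHToPi_of_isOfSurfaceType`,
  `isCommensurablyTerminal_range_piVToPi_of_isOfSurfaceType` — **for a connected semi-graph of
  anabelioids of surface type, possibly WITH CUSPS (open edges), assuming the named fact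
  `corollary_2_7_i` (F-1458) only: `Π_K ⊆ Π_𝒢` is commensurably terminal for every connected
  sub-semi-graph `K` with a vertex, and `Π_v ⊆ Π_𝒢` for every vertex `v`.**

Nothing here takes a side on [IUTchIII] Cor. 3.12; `corollary_2_7_i` enters BY NAME.
-/

namespace Literature.AnabelianGeometry.SemiGraphs

open CategoryTheory CategoryTheory.PreGaloisCategory
open Literature.AnabelianGeometry.Anabelioids

universe v₁ u₁ u

namespace SemiGraphOfAnabelioids

variable {𝒢 : SemiGraphOfAnabelioids.{v₁, u₁, u}} {Sigma : Set ℕ}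

/-! ### Surface type passes to sub-semi-graphs -/

/-- Injective type passes to the restriction to any sub-semi-graph (the branch morphisms of `𝒢_ℍ`
are among those of `𝒢`). [cite: MochizukiSemiAnbd2006, Def. 2.1 p.24] -/
theorem IsOfInjectiveType.restrict (h : 𝒢.IsOfInjectiveType) (H : 𝒢.graph.Subgraph) :
    (𝒢.restrict H).IsOfInjectiveType :=
  ⟨fun b v _ => h.isPi1Mono b.1 v.1 _⟩

/-- **Surface type passes to the restriction `𝒢_ℍ` to any sub-semi-graph `ℍ`**: the vertex groups
are the same pro-`Σ` surface groups, the branches of `ℍ` at a vertex are among those of `𝔾`, and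
the (injective) cusp assignment restricts. [cite: MochizukiSemiAnbd2006, Ex. 2.10 p.31] -/
theorem IsOfSurfaceType.restrict (hS : 𝒢.IsOfSurfaceType Sigma) (H : 𝒢.graph.Subgraph) :
    (𝒢.restrict H).IsOfSurfaceType Sigma := by
  refine ⟨hS.sigma_primes, hS.isOfInjectiveType.restrict H, fun v F _ => ?_⟩
  -- the basepoint `F` of `(𝒢_ℍ)_v = 𝒢_v` (same constituent anabelioid, definitionally)
  obtain ⟨g, r, ι, hhyp, hcompl, js, hjs, hbr⟩ :=
    @IsOfSurfaceType.vertex 𝒢 Sigma hS v.1 F (by assumption)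
  refine ⟨g, r, ι, hhyp, hcompl,
    fun b => js ⟨b.1.1, (H.abuts_eq_some_iff b.1 v).mp b.2⟩, fun b₁ b₂ h => ?_, fun b Fe _ => ?_⟩
  · exact Subtype.ext (Subtype.ext (congrArg (fun x => x.1) (hjs h)))
  · obtain ⟨α, hα⟩ := @hbr ⟨b.1.1, (H.abuts_eq_some_iff b.1 v).mp b.2⟩ Fe (by assumption)
    exact ⟨α, hα⟩

/-! ### The cusp-omitted graph of a surface-type semi-graph of anabelioids -/

/-- After omitting the open edges every edge abuts to a vertex (indeed is closed).
[cite: MochizukiSemiAnbd2006, §1 p.13] -/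
theorem everyEdgeAbuts_restrict_maximalSubgraph (𝒢 : SemiGraphOfAnabelioids.{v₁, u₁, u}) :
    (𝒢.restrict 𝒢.graph.maximalSubgraph).EveryEdgeAbuts := by
  intro e
  obtain ⟨b₁, -, -, h₁, -, -⟩ := 𝒢.graph.two_branches e.1
  have hb : 𝒢.graph.edgeOf b₁ ∈ 𝒢.graph.maximalSubgraph.edges := by rw [h₁]; exact e.2
  obtain ⟨v, hv⟩ := Option.isSome_iff_exists.mp (𝒢.graph.isSome_abuts_of_mem_maximalSubgraph hb)
  exact ⟨⟨b₁, hb⟩, ⟨v, trivial⟩, Subtype.ext h₁,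
    (𝒢.graph.maximalSubgraph.abuts_eq_some_iff ⟨b₁, hb⟩ ⟨v, trivial⟩).mpr hv⟩

/-- For `𝒢` of surface type, the cusp-omitted graph of anabelioids `𝒢_{𝔾_max}` is quasi-coherent
([SemiAnbd] Ex. 2.10 (1) for `𝒢_{𝔾_max}`, abc-iut-L3-t11's theorem).
[cite: MochizukiSemiAnbd2006, Ex. 2.10 p.31] -/
theorem isQuasiCoherent_restrict_maximalSubgraph_of_isOfSurfaceType
    (hS : 𝒢.IsOfSurfaceType Sigma) : (𝒢.restrict 𝒢.graph.maximalSubgraph).IsQuasiCoherent :=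
  isQuasiCoherent_of_isOfSurfaceType (everyEdgeAbuts_restrict_maximalSubgraph 𝒢)
    (hS.restrict 𝒢.graph.maximalSubgraph)

/-- For `𝒢` of surface type, the cusp-omitted graph of anabelioids `𝒢_{𝔾_max}` is totally elevated
([SemiAnbd] Ex. 2.10 (2) for `𝒢_{𝔾_max}`, abc-iut-L3-t11's theorem).
[cite: MochizukiSemiAnbd2006, Ex. 2.10 p.31] -/
theorem isTotallyElevated_restrict_maximalSubgraph_of_isOfSurfaceType
    (hS : 𝒢.IsOfSurfaceType Sigma) : (𝒢.restrict 𝒢.graph.maximalSubgraph).IsTotallyElevated :=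
  isTotallyElevated_of_isOfSurfaceType (everyEdgeAbuts_restrict_maximalSubgraph 𝒢)
    (hS.restrict 𝒢.graph.maximalSubgraph)

/-! ### Cor. 2.7 (i) for surface-type semi-graphs of anabelioids with cusps -/

/-- **[SemiAnbd] Cor. 2.7 (i), sub-semi-graph clause, for a semi-graph of anabelioids OF SURFACE
TYPE possibly WITH CUSPS** ([IUTchI] §2 p. 44 / Prop. 2.2 `hHatH`): assuming the named fact
`corollary_2_7_i` (F-1458), for `𝒢` connected of surface type and `K ⊆ 𝔾` a connected
sub-semi-graph with a vertex `w`, the decomposition subgroup `Π_K ⊆ Π_𝒢` is commensurably terminal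
(basepoint through `w`).  The cusps are omitted (`CuspOmissionSubgraph.lean`) and Cor. 2.7 (i) is
applied to the graph of anabelioids `𝒢_{𝔾_max}`, which is again of surface type.
[cite: Mochizuki2012, §2 p.44] -/
theorem isCommensurablyTerminal_range_piHToPi_of_isOfSurfaceType
    (h27 : corollary_2_7_i.{v₁, u₁, u}) (hS : 𝒢.IsOfSurfaceType Sigma) (h𝒢 : 𝒢.IsConnected)
    (K : 𝒢.graph.Subgraph) (hK : K.toSemiGraph.IsConnected) (w : K.toSemiGraph.Vertex)
    (F : 𝒢.V w.1 ⥤ FintypeCat.{v₁}) [FiberFunctor F] :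
    AbsoluteAnabelian.IsCommensurablyTerminal (𝒢.piHToPi K w F).range :=
  isCommensurablyTerminal_range_piHToPi_of_corollary_2_7_i h27 h𝒢
    (isQuasiCoherent_restrict_maximalSubgraph_of_isOfSurfaceType hS) K hK w
    (fun v => (isTotallyElevated_restrict_maximalSubgraph_of_isOfSurfaceType hS).isElevated
      ⟨v.1, trivial⟩) F

/-- **[SemiAnbd] Cor. 2.7 (i), vertex clause, for a semi-graph of anabelioids OF SURFACE TYPE
possibly WITH CUSPS**: assuming `corollary_2_7_i` (F-1458), for `𝒢` connected of surface type and
any vertex `v`, `Π_v ⊆ Π_𝒢` is commensurably terminal (every basepoint of `𝒢_v`).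
[cite: Mochizuki2012, §2 p.44] -/
theorem isCommensurablyTerminal_range_piVToPi_of_isOfSurfaceType
    (h27 : corollary_2_7_i.{v₁, u₁, u}) (hS : 𝒢.IsOfSurfaceType Sigma) (h𝒢 : 𝒢.IsConnected)
    (v : 𝒢.graph.Vertex) (F : 𝒢.V v ⥤ FintypeCat.{v₁}) [FiberFunctor F] :
    AbsoluteAnabelian.IsCommensurablyTerminal (𝒢.piVToPi v F).range :=
  isCommensurablyTerminal_range_piVToPi_of_corollary_2_7_i h27 h𝒢
    (isQuasiCoherent_restrict_maximalSubgraph_of_isOfSurfaceType hS) v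
    ((isTotallyElevated_restrict_maximalSubgraph_of_isOfSurfaceType hS).isElevated ⟨v, trivial⟩) F

end SemiGraphOfAnabelioids

end Literature.AnabelianGeometry.SemiGraphs
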